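import Summits.ABC.IUTFork.Repair.CandJoshi21Profile
import Summits.ABC.IUTFork.Repair.ScalarShellsThm311Zero
import HarnessLib

/-!
# IUT REPAIR branch (rung LADDER-ABC:A2.RP), rows RP-J03 / RP-J05 — T-c MODELS (∃-packages) for abc-iut-rp-j2's five candidates of
`Repair/CandJoshi21.lean` (p427435)

Proof-only companion (no `def`, no `Prop` fact, no instance) by the rows' PAIRED PROVER abc-iut-w4-d098 (gen 3), packaging the hold-sets
decided in `Repair/CandJoshi21Profile.lean` into the ∃-statements REPAIR-SPEC v0.2 §2 item 4 / §3 T-c asks for. (abc-iut-rp-j2 announced a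
`CandJoshi21Models` at 06:00Z; not staged by 07:05Z, so the paired prover files it — same name, same content class.)

RESULTS (all closed, axioms standard):
* `ansatzQReading_linkId`, `scalingIndeterminacy_linkId` — H_J21-1 / H_J21-2 HOLD at abc-iut-w5-d247's link-identified setting P♭
  (grade SAT0: the q-datum IS the Θ-datum there); packaged `levelRC_candidates_sat0`. By BAR-R (abc-iut-rp-j2's
  `not_ansatzQReading_of_scaledAt` / `not_scalingIndeterminacy_of_scaledAt`) neither can be SAT⁺: both imply the residual.
* `levelHS_candidates_satPlus` — at `(naiveFull 2, shellSetting 2 3, rhoOne 2 3, qDatum 2)`: typed Thm. 3.11 ∧ BridgeHyps ∧ `|log(q)| > 0`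
  ∧ PinnedRegions3 ∧ H_J21-3 ∧ H_J21-4 ∧ Statement ∧ ¬PilotKummerIndRelated — grade SAT⁺ (honest j²-scaling, label-independent q-volume),
  and at the same time THE CERTIFICATE «H_J21-3 ⇏ S»: the hull-level top-normalisation holds with all pins while the residual fails.
* `topNormalized_not_sufficient` — the packaged non-implication `¬ ∀ …, Thm 3.11 → BridgeHyps → AbsLogQPos → PinnedRegions3 → H_J21-3 → S`.
* H_J21-5 has NO model on the four families of record (`CandJoshi21Profile.nonIsometric_profile_empty`) but HOLDS, with the typed
  Thm. 3.11, on the SCALING situation of this seat's `Repair.ScalarShellsThm311` (`nonIsometric_holds_scaling`; situation-level T-c; the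
  setting-level package is abc-iut-rp-s2's `ObstructionSS10`); §4: H_J21-2 holds NON-TRIVIALLY (witness `sFamDep (cQ p)`, a genuine
  rescaling) for EVERY setting over `sFull₀ p` / `sFull p` with `qK = qDatum`, and H_J21-5 on `sSituation₀` too.

HONEST FRAMING: toys of the typed interface over `toyIndex`; nothing here asserts abc or [IUTchIII] Cor. 3.12 or takes a side between
Mochizuki / Scholze–Stix / Joshi; the H's are HYPOTHESES typed by abc-iut-rp-j2 — typed ≠ proved, instantiated ≠ endorsed.
[claim: Joshi2023ATS2Local, status: disputed]
-/

noncomputable section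

namespace Summit.ABC.IUTFork.Repair.CandJoshi21Models

open Thm311 Cor312 Cor312.Checks Cor312.IdentifiedNonVacuity Cor312Vol Literature.IUT.LogThetaLattice
open Cor312Vol.NaiveWitness Cor312Vol.PinnedWitness Cor312Vol.PinnedHonest
open Summit.ABC.IUTFork.Repair Summit.ABC.IUTFork.Repair.CandJoshi21Profile

variable (p : ℕ) [hp : Fact p.Prime]

/-! ## 1. Level R/C candidates: SAT0 at P♭ -/

/-- (T-c, SAT0) H_J21-1 holds at P♭: there the q-datum IS the line's splitting monoid, so both regions coincide. [folklore] -/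
theorem ansatzQReading_linkId :
    JoshiAnsatzQReading (naiveFull p).toLatticeSituation (linkIdSetting p) (GluedMonoids.Naive.ballOfMonoid p) fun v _ => Psi p v :=
  fun _ _ => rfl

/-- (T-c, SAT0) H_J21-2 holds at P♭ with the identity indeterminacy. [folklore] -/
theorem scalingIndeterminacy_linkId :
    JoshiScalingIndeterminacy (naiveFull p).toLatticeSituation (linkIdSetting p) fun v _ => Psi p v := by
  refine ⟨1, Subgroup.one_mem _, fun v hv => ?_⟩
  show Psi p v = (signShells.starAut 1 v) '' ((naiveSituation p).D (linkIdSetting p).n).Ψ v hv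
  rw [naive_Psi, LogShells.starAut_one]
  exact (Set.image_id _).symm

omit hp in
/-- **(T-c, packaged ∃, grade SAT0) for H_J21-1 and H_J21-2 together** at `(naiveFull 2, linkIdSetting 2, ballOfMonoid 2, Ψ)`: typed
Thm. 3.11 ∧ BridgeHyps ∧ `|log(q)| > 0` ∧ PinnedRegions3 ∧ H_J21-1 ∧ H_J21-2 (and the residual holds there). Degenerate by necessity: both
candidates imply the residual, which is false on every honestly scaled pinned setting (BAR-R). [claim: Joshi2023ATS2Local, status: disputed] -/
theorem levelRC_candidates_sat0 :
    ∃ (T : ThetaIndex) (F : FullSituation T) (P : Cor312.Setting F.toLatticeSituation.toSituation)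
      (ρ : (∀ v : T.V, v ∈ T.Vbad → Set (F.L.StarPacket v)) → ∀ (j : T.Label) (vQ : T.VQ), Set (F.L.Packet j vQ))
      (qK : ∀ v : T.V, v ∈ T.Vbad → Set (F.L.StarPacket v)),
      F.Statement ∧ BridgeHyps P ∧ P.AbsLogQPos ∧ PinnedRegions3 F.toLatticeSituation P ρ qK ∧
      JoshiAnsatzQReading F.toLatticeSituation P ρ qK ∧ JoshiScalingIndeterminacy F.toLatticeSituation P qK ∧
      PilotKummerIndRelated F.toLatticeSituation P ρ qK := by
  haveI : Fact (Nat.Prime 2) := ⟨Nat.prime_two⟩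
  exact ⟨toyIndex, naiveFull 2, linkIdSetting 2, GluedMonoids.Naive.ballOfMonoid 2, fun v _ => Psi 2 v, naiveFull_statement 2,
    linkId_bridgeHyps 2, linkId_absLogQPos 2, linkId_pinnedRegions3 2, ansatzQReading_linkId 2, scalingIndeterminacy_linkId 2,
    linkId_pilotKummerIndRelated 2⟩

/-! ## 2. Level H/S candidates: SAT⁺ on the log-shell family, and the «H_J21-3 ⇏ S» certificate -/

/-- **At every prime and every `d ≥ 3`**: typed Thm. 3.11 ∧ BridgeHyps ∧ `|log(q)| > 0` ∧ PinnedRegions3 (one honest operator) ∧ H_J21-3 ∧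
H_J21-4 ∧ Statement, while the residual FAILS. [claim: Joshi2023ATS2Local, status: disputed] -/
theorem levelHS_candidates_hold_on_ls (d : ℕ) (hd : 3 ≤ d) :
    (naiveFull p).Statement ∧ BridgeHyps (shellSetting p d) ∧ (shellSetting p d).AbsLogQPos ∧
      PinnedRegions3 (naiveFull p).toLatticeSituation (shellSetting p d) (rhoOne p d) (qDatum p) ∧
      JoshiTopNormalized (naiveFull p).toLatticeSituation (shellSetting p d) (rhoOne p d) (qDatum p) ∧
      JoshiLocalPrototype (shellSetting p d) ∧ Summit.ABC.IUTFork.Cor312.Setting.Statement (shellSetting p d) ∧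
      ¬ PilotKummerIndRelated (naiveFull p).toLatticeSituation (shellSetting p d) (rhoOne p d) (qDatum p) :=
  ⟨naiveFull_statement p, shell_bridgeHyps p d, shell_absLogQPos p d, oneRho_pinnedRegions3 p d, (topNormalized_oneRho_iff p d).2 hd,
    (localPrototype_shell_iff p d).2 hd, (shell_statement_iff p d).2 (by omega), CandMochizuki32.not_S_oneRho p d⟩

omit hp in
/-- **(T-c, packaged ∃, grade SAT⁺) for H_J21-3 and H_J21-4** at `(naiveFull 2, shellSetting 2 3, rhoOne 2 3, qDatum 2)`, with the Statement
holding and the residual failing — also THE KERNEL CERTIFICATE «H_J21-3 ⇏ PilotKummerIndRelated» under all pins and Thm. 3.11 that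
abc-iut-rp-j2 asked for. [claim: Joshi2023ATS2Local, status: disputed] -/
theorem levelHS_candidates_satPlus :
    ∃ (T : ThetaIndex) (F : FullSituation T) (P : Cor312.Setting F.toLatticeSituation.toSituation)
      (ρ : (∀ v : T.V, v ∈ T.Vbad → Set (F.L.StarPacket v)) → ∀ (j : T.Label) (vQ : T.VQ), Set (F.L.Packet j vQ))
      (qK : ∀ v : T.V, v ∈ T.Vbad → Set (F.L.StarPacket v)),
      F.Statement ∧ BridgeHyps P ∧ P.AbsLogQPos ∧ PinnedRegions3 F.toLatticeSituation P ρ qK ∧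
      JoshiTopNormalized F.toLatticeSituation P ρ qK ∧ JoshiLocalPrototype P ∧ P.Statement ∧
      ¬ PilotKummerIndRelated F.toLatticeSituation P ρ qK := by
  haveI : Fact (Nat.Prime 2) := ⟨Nat.prime_two⟩
  obtain ⟨h1, h2, h3, h4, h5, h6, h7, h8⟩ := levelHS_candidates_hold_on_ls 2 3 le_rfl
  exact ⟨toyIndex, naiveFull 2, shellSetting 2 3, rhoOne 2 3, qDatum 2, h1, h2, h3, h4, h5, h6, h7, h8⟩

/-- **`topNormalized_not_sufficient`** — H_J21-3 is NOT a level-R supplier: the implication «typed Thm. 3.11 ∧ BridgeHyps ∧ AbsLogQPos ∧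
PinnedRegions3 ∧ H_J21-3 ⟹ S» FAILS in the kernel (model above). It remains a level-H supplier (abc-iut-rp-j2's
`statement_of_topNormalized`). [claim: Joshi2023ATS2Local, status: disputed] -/
theorem topNormalized_not_sufficient :
    ¬ ∀ (T : ThetaIndex) (F : FullSituation T) (P : Cor312.Setting F.toLatticeSituation.toSituation)
        (ρ : (∀ v : T.V, v ∈ T.Vbad → Set (F.L.StarPacket v)) → ∀ (j : T.Label) (vQ : T.VQ), Set (F.L.Packet j vQ))
        (qK : ∀ v : T.V, v ∈ T.Vbad → Set (F.L.StarPacket v)),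
        F.Statement → BridgeHyps P → P.AbsLogQPos → PinnedRegions3 F.toLatticeSituation P ρ qK →
          JoshiTopNormalized F.toLatticeSituation P ρ qK → PilotKummerIndRelated F.toLatticeSituation P ρ qK := by
  intro h
  obtain ⟨T, F, P, ρ, qK, h1, h2, h3, h4, h5, -, -, h8⟩ := levelHS_candidates_satPlus
  exact h8 (h T F P ρ qK h1 h2 h3 h4 h5)

/-! ## 3. H_J21-5: no model on the families of record — but a model on the SCALING shells -/

/-- **H_J21-5 on the record**: on all four families (LS, EXP, FLIP, P♭) it FAILS (they share the naive situation, whose indeterminacies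
are the signs). [folklore] -/
theorem nonIsometric_no_model_of_record (d : ℕ) (e : toyIndex.LabelStar → ℕ) :
    ¬ JoshiNonIsometricIndeterminacy (naiveSituation p) (shellSetting p d).n ∧
      ¬ JoshiNonIsometricIndeterminacy (naiveSituation p) (expSetting p e).n ∧
      ¬ JoshiNonIsometricIndeterminacy (naiveSituation p) (flipSetting p).n ∧
      ¬ JoshiNonIsometricIndeterminacy (naiveSituation p) (linkIdSetting p).n :=
  nonIsometric_profile_empty p d e

/-- **H_J21-5 HOLDS on the SCALING situation of `Repair.ScalarShellsThm311`** (this seat's layers 1–2 of the scaling-shells model,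
abc-iut-rp-plan RULINGS #11): the (Ind2)-family «multiply by `p`» changes the log-volume of the admissible ball `B_0` at every line `n` —
so Joshi's non-isometric indeterminacy is INSTANTIATED (situation level) in a model where the typed Thm. 3.11 (i)–(iii) HOLDS
(`sFull_statement`). The price for settings over it (ball frames ⇒ `¬ThetaFinite`) is abc-iut-rp-j1's `CandJoshi3`/`CandJoshi7` §5 and
abc-iut-rp-s2's `ObstructionSS2/SS6`; the pinned setting itself is rp-s2's `ObstructionSS10` (per rp-plan 07:13:32Z). [folklore] -/
theorem nonIsometric_holds_scaling (n : ℤ) :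
    JoshiNonIsometricIndeterminacy (ScalarShellsThm311.sSituation p) n ∧ (ScalarShellsThm311.sFull p).Statement := by
  obtain ⟨Φ, hΦ, hadm, hne⟩ := ScalarShellsThm311.logvol_not_invariant p 0 () 0
  exact ⟨⟨Φ, hΦ, 0, (), _, hadm, hne⟩, ScalarShellsThm311.sFull_statement p⟩

/-! ## 4. H_J21-2 NON-TRIVIALLY and H_J21-5 on the scaling beds `sFull` / `sFull₀` (every setting) -/

/-- **H_J21-2 (scaling indeterminacy) HOLDS NON-TRIVIALLY over the scaling shells, for EVERY Cor.-3.12 setting over `sFull₀ p` and the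
q-pilot datum `qDatum`**: the witness is the label-dependent (Ind2)-family `sFamDep (cQ p)` = `(1, 1, p⁻¹)` of `Repair.ScalarShellsThm311`
(`starAut_cQ_Psi`: it carries `Ψ = {(±q^{j²})_j}` onto `{(±q)_j}`) — a GENUINE rescaling, not a sign (contrast: at P♭ the witness is `Φ = 1`,
`scalingIndeterminacy_linkId`; on LS/FLIP H_J21-2 fails). [folklore] -/
theorem scalingIndeterminacy_scaling₀ (P : Cor312.Setting (ScalarShellsThm311Zero.sFull₀ p).toLatticeSituation.toSituation) :
    JoshiScalingIndeterminacy (ScalarShellsThm311Zero.sFull₀ p).toLatticeSituation P (qDatum p) :=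
  ⟨ScalarShellsThm311.sFamDep p (ScalarShellsThm311.cQ p), ScalarShellsThm311.sFamDep_mem_closure p _,
    fun v hv => (ScalarShellsThm311.starAut_cQ_Psi p v hv).symm⟩

/-- The same over the layer-2 bed `sFull p` (pin-free uses). [folklore] -/
theorem scalingIndeterminacy_scaling (P : Cor312.Setting (ScalarShellsThm311.sFull p).toLatticeSituation.toSituation) :
    JoshiScalingIndeterminacy (ScalarShellsThm311.sFull p).toLatticeSituation P (qDatum p) :=
  ⟨ScalarShellsThm311.sFamDep p (ScalarShellsThm311.cQ p), ScalarShellsThm311.sFamDep_mem_closure p _,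
    fun v hv => (ScalarShellsThm311.starAut_cQ_Psi p v hv).symm⟩

/-- **H_J21-5 HOLDS on the `{0}`-admissible scaling situation `sSituation₀`** (the bed of the pinned door-(b) witnesses), with the typed
Thm. 3.11. [folklore] -/
theorem nonIsometric_holds_scaling₀ (n : ℤ) :
    JoshiNonIsometricIndeterminacy (ScalarShellsThm311Zero.sSituation₀ p) n ∧ (ScalarShellsThm311Zero.sFull₀ p).Statement := by
  obtain ⟨Φ, hΦ, hadm, hne⟩ := ScalarShellsThm311Zero.logvol_not_invariant₀ p 0 () 0
  exact ⟨⟨Φ, hΦ, 0, (), _, hadm, hne⟩, ScalarShellsThm311Zero.sFull₀_statement p⟩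

end Summit.ABC.IUTFork.Repair.CandJoshi21Models

end
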